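import Summits.CriticalPhenomena.PercolationContinuityZ3.Theorems.SahiBoxTP2Real
import Summits.CriticalPhenomena.PercolationContinuityZ3.Theorems.SahiTP2CellFKG
import Mathlib.Combinatorics.SetFamily.FourFunctions

/-!
# Box-TP₂ ⟺ cell-FKG on every grid, in every dimension

Support file of the Sahi cell (`prim-sahi`, typer seat, generation 11; `--supports stmt-CriticalPhenomena-4575`).

Two intrinsic total-positivity notions for an arbitrary (possibly singular) probability measure `μ` on the cube
`Q_d = (Fin d → [0,1])` coincide:
* `SahiBoxTP2Split.IsBoxTP2 μ` — `μ[a,b] μ[a',b'] ≤ μ[a∧a', b∧b'] μ[a∨a', b∨b']` for CLOSED boxes;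
* **cell-FKG on every grid** — for every `m`, the cell weights `c ↦ μ(cell_m c)` of the `(m+1)^d` grid
  (`SahiCubeDensity.cubeCellWeight μ m`, seat P1's / the paper's "width stratification" vocabulary) form an FKG
  weight on the finite distributive lattice `(Fin d → Fin (m+1))`.

`isFKGMeasure_cubeCellWeight_iff_isBoxTP2`: (⇐) each cell is the increasing union of closed boxes with corners
monotone in the cell index (explicit cell geometry `cellIdx_eq_iff`), so the lattice condition for cells is a
monotone limit of `IsBoxTP2` (`SahiBoxTP2Real.measure_mul_le_of_monotone_iUnion`); (⇒) the four functions theorem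
(Mathlib's `four_functions_theorem`) on the grid lattice gives the box inequality for unions of cells
("cell hulls" of closed boxes), and the cell hulls of `[a,b]` shrink to `[a,b]` as `m → ∞`
(`SahiTP2.eventually_cellIdx_lt`).  This is the `d`-dimensional form of generation 10's
`SahiTP2Rect.isFKGMeasure_cellWeight_iff_isRectTP2` (there `d = 2`, rectangles with order-connected sides).
Consequently every result of `SahiBoxTP2Positivity.lean` / `SahiBoxTP2GridThree.lean` applies verbatim to cell-FKG
laws (`msahiE_nonneg_of_cellFKG`).  No sorries, no new axioms.
-/

noncomputable section

namespace Summit.CriticalPhenomena.PercolationContinuityZ3.Theorems.SahiBoxTP2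

open MeasureTheory ProbabilityTheory Set Filter Topology Function Literature.Combinatorics.Sahi2008
open Literature.Combinatorics.Sahi2008.LebesgueSquare (gridPt cellIdx)
open Literature.Combinatorics.Sahi2008.LebesgueCube (cubeCell measurable_cubeCell cubeCell_mono)
open Summit.CriticalPhenomena.PercolationContinuityZ3.Theorems.SahiCubeDensity (cubeCellWeight cubeCell_inf
  cubeCell_sup)
open scoped ENNReal unitInterval

variable {d m : ℕ}

/-! ### Cell geometry on `[0,1]` -/

/-- Coordinates of grid points: `gridPt N a = a/N` for `a ≤ N`. [folklore] -/
theorem coe_gridPt_eq_div {N a : ℕ} (hN : 0 < N) (h : a ≤ N) : ((gridPt N a : I) : ℝ) = (a : ℝ) / N := by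
  change min ((a : ℝ) / N) 1 = _
  rw [min_eq_left]
  rw [div_le_one (by exact_mod_cast hN)]
  exact_mod_cast h

/-- Grid points increase with the index. [folklore] -/
theorem gridPt_le_gridPt (N : ℕ) {a b : ℕ} (hab : a ≤ b) : gridPt N a ≤ gridPt N b := by
  change (min ((a : ℝ) / N) 1) ≤ min ((b : ℝ) / N) 1
  exact min_le_min_right _ (div_le_div_of_nonneg_right (by exact_mod_cast hab) (Nat.cast_nonneg N))

/-- **Membership in a cell of `[0,1]`**: `cellIdx m x = i` iff `i/(m+1) ≤ x` and (`x < (i+1)/(m+1)` or `i = m`).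
[folklore] -/
theorem cellIdx_eq_iff (x : I) (i : Fin (m + 1)) :
    cellIdx m x = i ↔ (i : ℝ) / ((m : ℝ) + 1) ≤ (x : ℝ) ∧ ((i : ℕ) < m → (x : ℝ) < ((i : ℝ) + 1) / ((m : ℝ) + 1)) := by
  have hm : (0 : ℝ) < (m : ℝ) + 1 := by positivity
  have hx : (0 : ℝ) ≤ ((m : ℝ) + 1) * x := mul_nonneg hm.le x.2.1
  rw [Fin.ext_iff]
  change min ⌊((m : ℝ) + 1) * x⌋₊ m = (i : ℕ) ↔ _
  rw [div_le_iff₀ hm]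
  constructor
  · intro h
    rcases le_or_gt ⌊((m : ℝ) + 1) * x⌋₊ m with h' | h'
    · rw [min_eq_left h'] at h
      have hfl := (Nat.floor_eq_iff hx).1 h
      refine ⟨by linarith [hfl.1], fun _ => ?_⟩
      rw [lt_div_iff₀ hm]; linarith [hfl.2]
    · rw [min_eq_right h'.le] at h
      refine ⟨?_, fun hi => absurd h hi.ne'⟩
      have h1 : ((m : ℕ) : ℝ) ≤ ⌊((m : ℝ) + 1) * x⌋₊ := by exact_mod_cast h'.le
      have h2 := Nat.floor_le hx
      rw [← h]; linarith
  · rintro ⟨h1, h2⟩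
    rcases lt_or_eq_of_le (Nat.le_of_lt_succ i.2) with hi | hi
    · have h2' := h2 hi
      rw [lt_div_iff₀ hm] at h2'
      have hfl : ⌊((m : ℝ) + 1) * x⌋₊ = i := by
        rw [Nat.floor_eq_iff hx]; constructor <;> linarith
      rw [hfl, min_eq_left hi.le]
    · rw [hi, min_eq_right_iff, Nat.le_floor_iff hx]
      rw [hi] at h1; linarith

/-- Upper corner of the `k`-th inner approximation of cell `i`: `(i+1)/(m+1) − 1/((m+1)(k+2))` for `i < m`, and `1`
for the last cell. [folklore] -/
def cellHi (m k : ℕ) (i : Fin (m + 1)) : I :=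
  if (i : ℕ) < m then
    ⟨((i : ℝ) + 1) / ((m : ℝ) + 1) - 1 / (((m : ℝ) + 1) * ((k : ℝ) + 2)), by
      have hm : (0 : ℝ) < (m : ℝ) + 1 := by positivity
      have hk : (0 : ℝ) < (k : ℝ) + 2 := by positivity
      constructor
      · rw [sub_nonneg]
        calc (1 : ℝ) / (((m : ℝ) + 1) * ((k : ℝ) + 2)) ≤ 1 / ((m : ℝ) + 1) :=
              one_div_le_one_div_of_le hm (le_mul_of_one_le_right hm.le (by linarith))
          _ ≤ ((i : ℝ) + 1) / ((m : ℝ) + 1) :=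
              div_le_div_of_nonneg_right (by linarith [(Nat.cast_nonneg (i : ℕ) : (0 : ℝ) ≤ i)]) hm.le
      · have h1 : ((i : ℝ) + 1) / ((m : ℝ) + 1) ≤ 1 := by
          rw [div_le_one hm]
          have : ((i : ℕ) : ℝ) ≤ m := by exact_mod_cast Nat.le_of_lt_succ i.2
          linarith
        have h2 : (0 : ℝ) ≤ 1 / (((m : ℝ) + 1) * ((k : ℝ) + 2)) := by positivity
        linarith⟩
  else 1

/-- The coordinate of `cellHi` below the last cell. [folklore] -/
theorem coe_cellHi_of_lt {k : ℕ} {i : Fin (m + 1)} (hi : (i : ℕ) < m) :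
    ((cellHi m k i : I) : ℝ) = ((i : ℝ) + 1) / ((m : ℝ) + 1) - 1 / (((m : ℝ) + 1) * ((k : ℝ) + 2)) := by
  simp only [cellHi, hi, if_true]

/-- `cellHi` of the last cell is `1`. [folklore] -/
theorem cellHi_of_not_lt {k : ℕ} {i : Fin (m + 1)} (hi : ¬ (i : ℕ) < m) : cellHi m k i = 1 := by
  simp only [cellHi, hi, if_false]

/-- `cellHi` is monotone in the cell index. [folklore] -/
theorem cellHi_mono (m k : ℕ) : Monotone (cellHi m k) := by
  intro i i' hii'
  by_cases hi' : (i' : ℕ) < m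
  · have hi : (i : ℕ) < m := lt_of_le_of_lt hii' hi'
    apply Subtype.coe_le_coe.1
    rw [coe_cellHi_of_lt hi, coe_cellHi_of_lt hi']
    have hm : (0 : ℝ) < (m : ℝ) + 1 := by positivity
    have h : ((i : ℕ) : ℝ) ≤ ((i' : ℕ) : ℝ) := by exact_mod_cast hii'
    have := div_le_div_of_nonneg_right (show ((i : ℕ) : ℝ) + 1 ≤ ((i' : ℕ) : ℝ) + 1 by linarith) hm.le
    linarith
  · rw [cellHi_of_not_lt hi']
    exact le_top

/-- `cellHi` is monotone in the approximation level. [folklore] -/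
theorem cellHi_mono_level (m : ℕ) (i : Fin (m + 1)) : Monotone fun k => cellHi m k i := by
  intro k l hkl
  by_cases hi : (i : ℕ) < m
  · apply Subtype.coe_le_coe.1
    rw [coe_cellHi_of_lt hi, coe_cellHi_of_lt hi]
    have hm : (0 : ℝ) < (m : ℝ) + 1 := by positivity
    have hk : (0 : ℝ) < ((m : ℝ) + 1) * ((k : ℝ) + 2) := by positivity
    have hkl' : ((m : ℝ) + 1) * ((k : ℝ) + 2) ≤ ((m : ℝ) + 1) * ((l : ℝ) + 2) :=
      mul_le_mul_of_nonneg_left (by exact_mod_cast Nat.add_le_add_right hkl 2) hm.le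
    have := one_div_le_one_div_of_le hk hkl'
    linarith
  · change cellHi m k i ≤ cellHi m l i
    rw [cellHi_of_not_lt hi, cellHi_of_not_lt hi]

/-- **Each cell of `[0,1]` is the increasing union of the closed intervals `[i/(m+1), cellHi m k i]`.**
[folklore] -/
theorem cellIdx_eq_iff_exists (x : I) (i : Fin (m + 1)) :
    cellIdx m x = i ↔ ∃ k : ℕ, gridPt (m + 1) i ≤ x ∧ x ≤ cellHi m k i := by
  have hm : (0 : ℝ) < (m : ℝ) + 1 := by positivity
  have hgrid : ((gridPt (m + 1) i : I) : ℝ) = (i : ℝ) / ((m : ℝ) + 1) := by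
    rw [coe_gridPt_eq_div (Nat.succ_pos m) i.2.le]; push_cast; rfl
  rw [cellIdx_eq_iff]
  constructor
  · rintro ⟨h1, h2⟩
    by_cases hi : (i : ℕ) < m
    · have h2' := h2 hi
      -- choose `k` with `1/((m+1)(k+2)) ≤ (i+1)/(m+1) - x`
      obtain ⟨k, hk⟩ := exists_nat_one_div_lt (sub_pos.2 h2')
      refine ⟨k, Subtype.coe_le_coe.1 (by rw [hgrid]; exact h1), Subtype.coe_le_coe.1 ?_⟩
      rw [coe_cellHi_of_lt hi]
      have hk2 : (1 : ℝ) / (((m : ℝ) + 1) * ((k : ℝ) + 2)) ≤ 1 / ((k : ℝ) + 1) := by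
        refine one_div_le_one_div_of_le (by positivity) ?_
        calc (k : ℝ) + 1 ≤ 1 * ((k : ℝ) + 2) := by linarith
          _ ≤ ((m : ℝ) + 1) * ((k : ℝ) + 2) :=
            mul_le_mul_of_nonneg_right (by linarith [(Nat.cast_nonneg m : (0 : ℝ) ≤ m)]) (by positivity)
      linarith
    · exact ⟨0, Subtype.coe_le_coe.1 (by rw [hgrid]; exact h1), by rw [cellHi_of_not_lt hi]; exact le_top⟩
  · rintro ⟨k, h1, h2⟩
    refine ⟨by rw [← hgrid]; exact Subtype.coe_le_coe.2 h1, fun hi => ?_⟩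
    have h2' := Subtype.coe_le_coe.2 h2
    rw [coe_cellHi_of_lt hi] at h2'
    have hpos : (0 : ℝ) < 1 / (((m : ℝ) + 1) * ((k : ℝ) + 2)) := by positivity
    linarith

/-! ### Cells of `Q_d` as increasing unions of closed boxes -/

/-- Lower corner of cell `c`: the grid point `(c_j/(m+1))_j`. [folklore] -/
def cellLoCorner (m : ℕ) (c : Fin d → Fin (m + 1)) : Fin d → I := fun j => gridPt (m + 1) (c j)

/-- Upper corner of the `k`-th inner approximation of cell `c`. [folklore] -/
def cellHiCorner (m k : ℕ) (c : Fin d → Fin (m + 1)) : Fin d → I := fun j => cellHi m k (c j)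

/-- **A cell of the `(m+1)^d` grid is the increasing union of closed boxes.** [folklore] -/
theorem cubeCell_preimage_singleton_eq_iUnion (c : Fin d → Fin (m + 1)) :
    (cubeCell m ⁻¹' {c} : Set (Fin d → I)) = ⋃ k : ℕ, Icc (cellLoCorner m c) (cellHiCorner m k c) := by
  ext x
  simp only [mem_preimage, mem_singleton_iff, mem_iUnion, mem_Icc]
  constructor
  · intro h
    have hj : ∀ j, ∃ k : ℕ, gridPt (m + 1) (c j) ≤ x j ∧ x j ≤ cellHi m k (c j) := fun j =>
      (cellIdx_eq_iff_exists (x j) (c j)).1 (by rw [← h]; rfl)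
    choose k hk using hj
    refine ⟨Finset.univ.sup k, fun j => (hk j).1, fun j => (hk j).2.trans ?_⟩
    exact cellHi_mono_level m (c j) (Finset.le_sup (Finset.mem_univ j))
  · rintro ⟨k, h1, h2⟩
    funext j
    exact (cellIdx_eq_iff_exists (x j) (c j)).2 ⟨k, h1 j, h2 j⟩

/-- The approximating boxes increase with the level. [folklore] -/
theorem monotone_cellBox (c : Fin d → Fin (m + 1)) :
    Monotone fun k : ℕ => Icc (cellLoCorner m c) (cellHiCorner m k c) :=
  fun _ _ hkl => Icc_subset_Icc le_rfl fun j => cellHi_mono_level m (c j) hkl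

/-- The lower corner is a lattice homomorphism in the cell index (meets). [folklore] -/
theorem cellLoCorner_inf (c c' : Fin d → Fin (m + 1)) :
    cellLoCorner m (c ⊓ c') = cellLoCorner m c ⊓ cellLoCorner m c' := by
  funext j
  simp only [cellLoCorner, Pi.inf_apply]
  rcases le_total (c j) (c' j) with h | h
  · rw [inf_eq_left.2 h, inf_eq_left.2 (gridPt_le_gridPt _ h)]
  · rw [inf_eq_right.2 h, inf_eq_right.2 (gridPt_le_gridPt _ h)]

/-- The lower corner is a lattice homomorphism in the cell index (joins). [folklore] -/
theorem cellLoCorner_sup (c c' : Fin d → Fin (m + 1)) :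
    cellLoCorner m (c ⊔ c') = cellLoCorner m c ⊔ cellLoCorner m c' := by
  funext j
  simp only [cellLoCorner, Pi.sup_apply]
  rcases le_total (c j) (c' j) with h | h
  · rw [sup_eq_right.2 h, sup_eq_right.2 (gridPt_le_gridPt _ h)]
  · rw [sup_eq_left.2 h, sup_eq_left.2 (gridPt_le_gridPt _ h)]

/-- The upper corners are lattice homomorphisms in the cell index (meets). [folklore] -/
theorem cellHiCorner_inf (k : ℕ) (c c' : Fin d → Fin (m + 1)) :
    cellHiCorner m k (c ⊓ c') = cellHiCorner m k c ⊓ cellHiCorner m k c' := by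
  funext j
  simp only [cellHiCorner, Pi.inf_apply]
  rcases le_total (c j) (c' j) with h | h
  · rw [inf_eq_left.2 h, inf_eq_left.2 (cellHi_mono m k h)]
  · rw [inf_eq_right.2 h, inf_eq_right.2 (cellHi_mono m k h)]

/-- The upper corners are lattice homomorphisms in the cell index (joins). [folklore] -/
theorem cellHiCorner_sup (k : ℕ) (c c' : Fin d → Fin (m + 1)) :
    cellHiCorner m k (c ⊔ c') = cellHiCorner m k c ⊔ cellHiCorner m k c' := by
  funext j
  simp only [cellHiCorner, Pi.sup_apply]
  rcases le_total (c j) (c' j) with h | h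
  · rw [sup_eq_right.2 h, sup_eq_right.2 (cellHi_mono m k h)]
  · rw [sup_eq_left.2 h, sup_eq_left.2 (cellHi_mono m k h)]

/-! ### Box-TP₂ ⟹ cell-FKG on every grid -/

/-- Cells are measurable. [folklore] -/
theorem measurableSet_cubeCell_preimage (S : Set (Fin d → Fin (m + 1))) :
    MeasurableSet (cubeCell m ⁻¹' S : Set (Fin d → I)) :=
  measurable_cubeCell m (MeasurableSet.of_discrete)

/-- **Box-TP₂ laws are cell-FKG on every grid.** [this work] -/
theorem IsBoxTP2.isFKGMeasure_cubeCellWeight (μ : Measure (Fin d → I)) [IsProbabilityMeasure μ] (hμ : IsBoxTP2 μ)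
    (m : ℕ) : IsFKGMeasure (cubeCellWeight μ m) where
  nonneg c := SahiCubeDensity.cubeCellWeight_nonneg μ c
  sum_eq_one := SahiCubeDensity.sum_cubeCellWeight μ
  mul_le_mul c c' := by
    have key : μ (cubeCell m ⁻¹' {c}) * μ (cubeCell m ⁻¹' {c'}) ≤
        μ (cubeCell m ⁻¹' {c ⊓ c'}) * μ (cubeCell m ⁻¹' {c ⊔ c'}) := by
      rw [cubeCell_preimage_singleton_eq_iUnion, cubeCell_preimage_singleton_eq_iUnion,
        cubeCell_preimage_singleton_eq_iUnion, cubeCell_preimage_singleton_eq_iUnion]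
      refine measure_mul_le_of_monotone_iUnion μ (monotone_cellBox c) (monotone_cellBox c')
        (monotone_cellBox _) (monotone_cellBox _) fun k => ?_
      have h := hμ (cellLoCorner m c) (cellHiCorner m k c) (cellLoCorner m c') (cellHiCorner m k c')
      rwa [← cellLoCorner_inf, ← cellHiCorner_inf, ← cellLoCorner_sup, ← cellHiCorner_sup] at h
    simp only [cubeCellWeight, measureReal_def]
    rw [← ENNReal.toReal_mul, ← ENNReal.toReal_mul]
    exact ENNReal.toReal_mono (ENNReal.mul_ne_top (measure_ne_top _ _) (measure_ne_top _ _)) key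

/-! ### Cell-FKG on every grid ⟹ box-TP₂ -/

/-- The mass of a union of cells is the cell-weight sum. [folklore] -/
theorem measureReal_cubeCell_preimage (μ : Measure (Fin d → I)) [IsFiniteMeasure μ]
    (S : Finset (Fin d → Fin (m + 1))) :
    μ.real (cubeCell m ⁻¹' ↑S) = ∑ c ∈ S, cubeCellWeight μ m c := by
  rw [← sum_measureReal_preimage_singleton S fun c _ => measurableSet_cubeCell_preimage {c}]
  rfl

/-- **Four functions on the grid**: for an FKG weight on `(Fin d → Fin (m+1))` and two boxes of cells,
`w[p,q] w[p',q'] ≤ w[p∧p', q∧q'] w[p∨p', q∨q']`. [folklore] -/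
theorem sum_Icc_mul_sum_Icc_le_of_isFKGMeasure {w : (Fin d → Fin (m + 1)) → ℝ} (hw : IsFKGMeasure w)
    (p q p' q' : Fin d → Fin (m + 1)) :
    (∑ c ∈ Finset.Icc p q, w c) * (∑ c ∈ Finset.Icc p' q', w c) ≤
      (∑ c ∈ Finset.Icc (p ⊓ p') (q ⊓ q'), w c) * (∑ c ∈ Finset.Icc (p ⊔ p') (q ⊔ q'), w c) := by
  classical
  have h4 := four_functions_theorem w w w w hw.nonneg hw.nonneg hw.nonneg hw.nonneg hw.mul_le_mul
    (Finset.Icc p q) (Finset.Icc p' q')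
  refine h4.trans (mul_le_mul ?_ ?_ (Finset.sum_nonneg fun c _ => hw.nonneg c)
    (Finset.sum_nonneg fun c _ => hw.nonneg c))
  · refine Finset.sum_le_sum_of_subset_of_nonneg (fun c hc => ?_) fun c _ _ => hw.nonneg c
    obtain ⟨a, ha, b, hb, rfl⟩ := Finset.mem_infs.1 hc
    rw [Finset.mem_Icc] at ha hb ⊢
    exact ⟨inf_le_inf ha.1 hb.1, inf_le_inf ha.2 hb.2⟩
  · refine Finset.sum_le_sum_of_subset_of_nonneg (fun c hc => ?_) fun c _ _ => hw.nonneg c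
    obtain ⟨a, ha, b, hb, rfl⟩ := Finset.mem_sups.1 hc
    rw [Finset.mem_Icc] at ha hb ⊢
    exact ⟨sup_le_sup ha.1 hb.1, sup_le_sup ha.2 hb.2⟩

/-- The cell hull of a closed box at grid level `m`. [folklore] -/
def cellHull (m : ℕ) (a b : Fin d → I) : Set (Fin d → I) :=
  cubeCell m ⁻¹' ↑(Finset.Icc (cubeCell m a) (cubeCell m b))

/-- Cell hulls are measurable. [folklore] -/
theorem measurableSet_cellHull (m : ℕ) (a b : Fin d → I) : MeasurableSet (cellHull m a b) :=
  measurableSet_cubeCell_preimage _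

/-- **The cell hulls of `[a,b]` shrink to `[a,b]`** (pointwise, eventually in `m`). [this work] -/
theorem eventually_mem_cellHull_iff (a b x : Fin d → I) : ∀ᶠ m : ℕ in atTop, (x ∈ cellHull m a b ↔ x ∈ Icc a b) := by
  have h1 : ∀ j, ∀ᶠ m : ℕ in atTop, (cellIdx m (a j) ≤ cellIdx m (x j) ↔ a j ≤ x j) := fun j =>
    SahiTP2.eventually_cellIdx_le_iff (a j) (x j)
  have h2 : ∀ j, ∀ᶠ m : ℕ in atTop, (cellIdx m (x j) ≤ cellIdx m (b j) ↔ x j ≤ b j) := fun j =>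
    SahiTP2.eventually_cellIdx_le_iff (x j) (b j)
  filter_upwards [eventually_all.2 h1, eventually_all.2 h2] with m hm1 hm2
  change (cubeCell m x ∈ (↑(Finset.Icc (cubeCell m a) (cubeCell m b)) : Set (Fin d → Fin (m + 1)))) ↔ x ∈ Icc a b
  rw [Finset.coe_Icc, mem_Icc, mem_Icc, Pi.le_def, Pi.le_def, Pi.le_def, Pi.le_def]
  exact and_congr (forall_congr' fun j => hm1 j) (forall_congr' fun j => hm2 j)

/-- The masses of the cell hulls converge to the mass of the box. [this work] -/
theorem tendsto_measure_cellHull (μ : Measure (Fin d → I)) [IsFiniteMeasure μ] (a b : Fin d → I) :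
    Tendsto (fun m : ℕ => μ (cellHull m a b)) atTop (𝓝 (μ (Icc a b))) :=
  tendsto_measure_of_tendsto_indicator_of_isFiniteMeasure atTop μ (fun m => measurableSet_cellHull m a b)
    fun x => eventually_mem_cellHull_iff a b x

/-- The cell-hull inequality at a fixed grid level, for a cell-FKG law. [this work] -/
theorem measure_cellHull_mul_le (μ : Measure (Fin d → I)) [IsProbabilityMeasure μ]
    (hμ : IsFKGMeasure (cubeCellWeight μ m)) (a b a' b' : Fin d → I) :
    μ (cellHull m a b) * μ (cellHull m a' b') ≤
      μ (cellHull m (a ⊓ a') (b ⊓ b')) * μ (cellHull m (a ⊔ a') (b ⊔ b')) := by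
  have key := sum_Icc_mul_sum_Icc_le_of_isFKGMeasure hμ (cubeCell m a) (cubeCell m b) (cubeCell m a')
    (cubeCell m b')
  rw [← measureReal_cubeCell_preimage, ← measureReal_cubeCell_preimage, ← measureReal_cubeCell_preimage,
    ← measureReal_cubeCell_preimage, ← cubeCell_inf, ← cubeCell_inf, ← cubeCell_sup, ← cubeCell_sup] at key
  simp only [measureReal_def] at key
  rw [← ENNReal.toReal_mul, ← ENNReal.toReal_mul,
    ENNReal.toReal_le_toReal (ENNReal.mul_ne_top (measure_ne_top _ _) (measure_ne_top _ _))
      (ENNReal.mul_ne_top (measure_ne_top _ _) (measure_ne_top _ _))] at key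
  exact key

/-- **Cell-FKG on every grid implies box-TP₂.** [this work] -/
theorem isBoxTP2_of_isFKGMeasure_cubeCellWeight (μ : Measure (Fin d → I)) [IsProbabilityMeasure μ]
    (hμ : ∀ m, IsFKGMeasure (cubeCellWeight μ m)) : IsBoxTP2 μ := by
  intro a b a' b'
  exact le_of_tendsto_of_tendsto'
    (ENNReal.Tendsto.mul (tendsto_measure_cellHull μ a b) (Or.inr (measure_ne_top _ _))
      (tendsto_measure_cellHull μ a' b') (Or.inr (measure_ne_top _ _)))
    (ENNReal.Tendsto.mul (tendsto_measure_cellHull μ _ _) (Or.inr (measure_ne_top _ _))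
      (tendsto_measure_cellHull μ _ _) (Or.inr (measure_ne_top _ _)))
    fun m => measure_cellHull_mul_le μ (hμ m) a b a' b'

/-- **Box-TP₂ ⟺ cell-FKG on every grid** (every dimension; singular laws allowed). [this work] -/
theorem isFKGMeasure_cubeCellWeight_iff_isBoxTP2 (μ : Measure (Fin d → I)) [IsProbabilityMeasure μ] :
    (∀ m, IsFKGMeasure (cubeCellWeight μ m)) ↔ IsBoxTP2 μ :=
  ⟨isBoxTP2_of_isFKGMeasure_cubeCellWeight μ, fun h m => h.isFKGMeasure_cubeCellWeight μ m⟩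

/-- **Cell-FKG laws on `Q_d` are Sahi-positive of order `n` given `LiebSahiContinuum d n`**, all measurable
nonnegative monotone families. [this work] -/
theorem msahiE_nonneg_of_cellFKG {n : ℕ} (h : LiebSahiContinuum d n) (μ : Measure (Fin d → I))
    [IsProbabilityMeasure μ] (hμ : ∀ m, IsFKGMeasure (cubeCellWeight μ m)) (f : Fin n → (Fin d → I) → ℝ)
    (hfm : ∀ i, Measurable (f i)) (hf0 : ∀ i x, 0 ≤ f i x) (hmono : ∀ i, Monotone (f i)) : 0 ≤ msahiE μ n f :=
  msahiE_nonneg_of_isBoxTP2 h μ (isBoxTP2_of_isFKGMeasure_cubeCellWeight μ hμ) f hfm hf0 hmono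

end Summit.CriticalPhenomena.PercolationContinuityZ3.Theorems.SahiBoxTP2
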